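import Summits.KontsevichZagierPeriods.KontsevichZagierPeriods.Theses.Deregularisation
import Literature.NumberTheory.Transcendental.KZRegCalculusProofs

/-!
# `ShellOfKZreg` (stmt-KontsevichZagierPeriods-14296, route Deregularisation) — proof

Glue item of route Deregularisation: the two KZreg cruxes `RegConservative2`
(`= KZreg.Conservative`: the de-regularisation `Λ` maps relations of the regularised calculus to
KZ relations) and `RegKernel2` (repaired form: every vanishing `ℤ`-combination of ordinary KZ
representations is the de-regularisation `Λ d` of a KZreg relation `d`) instantiate the typed
shell `DeregularisationShell` with the KZreg data
`L := KZreg.FormalRep`, `ev := KZreg.eval`, `ι := KZreg.incl`, `Λ := KZreg.Λ` and the relation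
subgroup `rel := KZreg.relations ⊔ KZreg.defects` (the relations with the regularisation defects
`[r] − incl (Λ [r])` adjoined — the calculus "in which each representation is identified with the
inclusion of its finite part", as the docstring of `RegKernel2` puts it; the bare
`rel := KZreg.relations` would make the shell's kernel clause the refuted v1 statement
`KZreg.KernelConjecture`, `KZreg.not_kernelConjecture`). The four shell clauses are then
`KZreg.Λ_incl`, `KZreg.eval_incl`, `KZreg.ker_eval_le_relations_sup_defects` applied to the
ordinary kernel conjecture (which the two cruxes give in two lines), and
`Λ (relations ⊔ defects) ≤ KZ.relations` (`RegConservative2` on the first summand,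
`KZreg.defects_le_ker_Λ` on the second) — all proved in
`Literature/NumberTheory/Transcendental/KZRegCalculus(Proofs).lean`. Pure logic over route
declarations; landed by lead c10 of crux stmt-KontsevichZagierPeriods-9129 (banking). No
definitions.
-/

namespace Summit.KontsevichZagierPeriods.Deregularisation

open Summit.KontsevichZagierPeriods.KontsevichZagierPeriods.Theses.Deregularisation
open Literature.NumberTheory.Transcendental

/-- **`ShellOfKZreg`** (route Deregularisation, stmt-KontsevichZagierPeriods-14296):
`RegConservative2 → RegKernel2 → DeregularisationShell`. Proof: take `L := KZreg.FormalRep`,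
`rel := KZreg.relations ⊔ KZreg.defects`, `ev := KZreg.eval`, `ι := KZreg.incl`, `Λ := KZreg.Λ`.
Then `Λ ∘ ι = id` is `KZreg.Λ_incl` and `ev ∘ ι = KZ.eval` is `KZreg.eval_incl`; the two cruxes give
the ordinary kernel conjecture (`KZ.eval c = 0` ⇒ `c = Λ d` with `d ∈ KZreg.relations` by
`RegKernel2` ⇒ `c ∈ KZ.relations` by `RegConservative2`), whence `ker ev ≤ rel` by
`KZreg.ker_eval_le_relations_sup_defects`; and `Λ` maps `rel` into `KZ.relations` because it maps
`KZreg.relations` there (`RegConservative2`) and kills `KZreg.defects` (`KZreg.defects_le_ker_Λ`).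
[folklore] -/
theorem shellOfKZreg_proof :
    Summit.KontsevichZagierPeriods.KontsevichZagierPeriods.Theses.Deregularisation.ShellOfKZreg := by
  intro hC hK
  -- the ordinary kernel conjecture from the two cruxes
  have hk : KZKernelConjecture := by
    intro c h0
    obtain ⟨d, hd, rfl⟩ := hK c h0
    exact hC d hd
  refine ⟨KZreg.FormalRep, inferInstance, KZreg.relations ⊔ KZreg.defects, KZreg.eval, KZreg.incl,
    KZreg.Λ, KZreg.Λ_incl, KZreg.eval_incl, ?_, ?_⟩
  · intro d hd
    exact KZreg.ker_eval_le_relations_sup_defects hk (by rw [AddMonoidHom.mem_ker]; exact hd)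
  · intro d hd
    have h2 : KZreg.relations ⊔ KZreg.defects ≤ KZ.relations.comap KZreg.Λ := by
      refine sup_le (KZreg.conservative_iff_le_comap.1 hC) fun x hx => ?_
      have hx0 : KZreg.Λ x = 0 := KZreg.defects_le_ker_Λ hx
      rw [AddSubgroup.mem_comap, hx0]
      exact zero_mem _
    exact h2 hd

end Summit.KontsevichZagierPeriods.Deregularisation
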